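import Summits.BirchSwinnertonDyer.BirchSwinnertonDyer.Theses.PAdicOrderV2
import Literature.NumberTheory.EllipticCurves.PAdicBSD
import Literature.NumberTheory.EllipticCurves.CyclotomicIwasawaMainTheoremIrreducible
import HarnessLib

/-!
# BirchSwinnertonDyer / PAdicOrderV2 — crux `PAdicOrderComparisonR2`
# (stmt-BirchSwinnertonDyer-0489), line `Sketch`, stub `stub_mainConjecture_inPrint`: the
# cyclotomic main conjecture in `Λ ⊗ ℚ_p` in its PRINTED cases with irreducible `ρ̄_{E,p}` —
# conditional closure

Registered stub MC-print of the skeleton `Cruxes/PAdicOrderComparisonR2/Lines/Sketch.lean` (v8):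
for `E/ℚ` (globally minimal `W`), a good ordinary prime `p ≥ 3` with `ρ̄_{E,p}` irreducible and
EITHER `p ≥ 5` OR an auxiliary multiplicative prime `ℓ ≠ p` with `p ∤ v_ℓ(Δ_min)`, the cyclotomic
`ℤ_p`-extension `κ` with topological generator `γ` matching the cyclotomic variable, the newform
`f` of `E` and any Pontryagin-dual datum `D`: `X = D.X` is `Λ`-torsion and `char_Λ X = (g)` with
`ι g = p^k · L_p(E, T)` for some `k ∈ ℤ` (`L_p = padicLFunction f (unitRoot W p)`).

This statement is LITERATURE DEBT, not open mathematics, and it is not provable in the tree today: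
its two printed cases are

* Skinner–Urban, Invent. Math. 195 (2014), Thm. 3.6.9 (with Kato, Astérisque 295, Thm. 17.4):
  binder for binder clauses (1)–(2) of the tree's named fact
  `Literature.NumberTheory.EllipticCurves.skinner_urban_main_conjecture` (`PAdicBSD`, bsd.S21;
  a `def … : Prop` without `_holds`);
* Burungale–Castella–Skinner, IMRN 2025 = arXiv:2405.00270, Thm. 1.1.2 (a) (`p > 3`, `E[p]`
  irreducible, NO auxiliary prime): the tree's named fact
  `Literature.NumberTheory.EllipticCurves.burungale_castella_skinner_charIdeal_eq_padicLFunction`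
  (`CyclotomicIwasawaMainTheoremIrreducible`, bsd.S21′: stated in the tree's vocabulary and in
  the clause shape of bsd.S21 by this seat and relocated there by the gate, p108009; a
  `def … : Prop` without `_holds` — Kato's Euler system, Eisenstein congruences on unitary groups
  and Hida theory over CM fields are far outside Mathlib and the tree).

`stub_mainConjecture_inPrint_of_facts` records, machine-checked, that the stub FOLLOWS from
(the ∀-closure of) these two named facts: it is stated in colon form
`hSU → hBCS → <registered stub signature verbatim>`, where `hSU` is the ∀-closure of bsd.S21
over its section variables and `hBCS` the B–C–S fact, and registered as a sub-goal of the crux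
(`ledger workitem stub-add`). Proof: case on the auxiliary prime — present ⇒ S–U (this also
covers `p = 3`), absent ⇒ the disjunction forces `5 ≤ p` and B–C–S applies.
Deliberately NOT here: the residual cases (stub MC-res: Eisenstein `p`; `p = 3` without
auxiliary prime), the control theorem, Kato's corank bound (other stubs of the line).
-/

-- single-conjunct summit: `Summit.BirchSwinnertonDyer.BirchSwinnertonDyer.…` repeats the name
-- by design
set_option linter.dupNamespace false

namespace Summit.BirchSwinnertonDyer.BirchSwinnertonDyer.Theorems

open Literature.NumberTheory.EllipticCurves

/-- **Stub MC-print is the ∀-closure of clauses (1)–(2) of the tree fact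
`skinner_urban_main_conjecture`** (Skinner–Urban 2014, Thm. 3.6.9, with Kato, Thm. 17.4)
**together with Burungale–Castella–Skinner's Thm. 1.1.2 (a)** (the named fact
`Literature.NumberTheory.EllipticCurves.burungale_castella_skinner_charIdeal_eq_padicLFunction`,
bsd.S21′: `p ≥ 5` good ordinary, `E[p]` irreducible ⇒ `X` torsion and `char_Λ X = (L_p)` in
`Λ ⊗ ℚ_p`). Colon form: first antecedent `hSU` = the ∀-closure of bsd.S21 over its section
variables `W, p, κ, γ, N, f` (written `@skinner_urban_main_conjecture W _ p _ κ γ N _ f`, the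
same term as the skeleton's `skinner_urban_main_conjecture W p (κ := κ) (γ := γ) (f := f)`;
bsd.S21 does not take `[W.IsElliptic]`, which is kept in the closure as in the skeleton); second
antecedent `hBCS` = bsd.S21′; the consequent is the registered stub
`stub_mainConjecture_inPrint` of line `Sketch` verbatim. The proof cases on the
auxiliary multiplicative prime: present ⇒ `hSU` (which also covers `p = 3`), absent ⇒ the
hypothesis `5 ≤ p ∨ ∃ ℓ, …` yields `5 ≤ p` and `hBCS` applies. No mathematics beyond the two
cited theorems.
[cite: SkinnerUrban2014, Thm. 3.6.9 (p. 45)]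
[cite: BurungaleCastellaSkinner2025, Thm. 1.1.2 (a) (p. 2 of arXiv:2405.00270v2)] -/
theorem stub_mainConjecture_inPrint_of_facts :
    (∀ (W : WeierstrassCurve ℚ) [W.IsElliptic] [W.IsGloballyMinimal] (p : ℕ) [Fact p.Prime]
      (κ : Literature.NumberTheory.EllipticCurves.ZpExtension ℚ p) (γ : Field.absoluteGaloisGroup ℚ)
      {N : ℕ} [NeZero N] (f : CuspForm (CongruenceSubgroup.Gamma0 N) 2),
      @Literature.NumberTheory.EllipticCurves.skinner_urban_main_conjecture W _ p _ κ γ N _ f) →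
    Literature.NumberTheory.EllipticCurves.burungale_castella_skinner_charIdeal_eq_padicLFunction →
    ∀ (W : WeierstrassCurve ℚ) [W.IsElliptic] [W.IsGloballyMinimal] (p : ℕ) [Fact p.Prime],
      3 ≤ p → W.HasGoodReductionAtPrime p → ¬ (p : ℤ) ∣ W.frobeniusTrace p →
      W.HasIrreducibleModPGaloisRep p →
      (5 ≤ p ∨ ∃ ℓ : ℕ, ∃ _ : Fact ℓ.Prime, ℓ ≠ p ∧ W.HasMultiplicativeReductionAtPrime ℓ ∧
        ¬ p ∣ padicValInt ℓ W.minimalDiscriminantInt) →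
      ∀ (κ : Literature.NumberTheory.EllipticCurves.ZpExtension ℚ p) (γ : Field.absoluteGaloisGroup ℚ),
        κ.IsCyclotomic → κ.IsTopGenerator γ →
        Literature.NumberTheory.EllipticCurves.IsCyclotomicVariable p γ →
      ∀ {N : ℕ} [NeZero N] (f : CuspForm (CongruenceSubgroup.Gamma0 N) 2),
        Literature.NumberTheory.EllipticCurves.ModularForms.IsNewformOf W f →
      ∀ (D : W.SelmerDualData κ γ),
        D.IsTorsion ∧
          ∃ (g : Literature.NumberTheory.EllipticCurves.IwasawaAlgebra p) (k : ℤ),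
            D.charIdeal = Ideal.span {g} ∧
              Literature.NumberTheory.EllipticCurves.iwasawaToPowerSeries p g =
                PowerSeries.C ((p : ℚ_[p]) ^ k) *
                  Literature.NumberTheory.EllipticCurves.padicLFunction f
                    (Literature.NumberTheory.EllipticCurves.unitRoot W p : ℚ_[p]) := by
  intro hSU hBCS W _ _ p _ hp hgood hord hirr hcase κ γ hκ hγ hγ' N _ f hf D
  -- the Skinner–Urban case first (it also covers `p = 3`), Burungale–Castella–Skinner otherwise
  by_cases haux : ∃ ℓ : ℕ, ∃ _ : Fact ℓ.Prime, ℓ ≠ p ∧ W.HasMultiplicativeReductionAtPrime ℓ ∧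
      ¬ p ∣ padicValInt ℓ W.minimalDiscriminantInt
  · have h := hSU W p κ γ f hp hgood hord hirr haux hκ hγ hγ' hf D
    exact ⟨h.1, h.2.1⟩
  · exact hBCS W p κ γ f (hcase.resolve_right haux) hgood hord hirr hκ hγ hγ' hf D

end Summit.BirchSwinnertonDyer.BirchSwinnertonDyer.Theorems
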